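import Literature.RingTheory.MvPowerSeries.HasseDerivResidue
import Literature.RingTheory.MvPowerSeries.HasseDerivFrobeniusPow
import HarnessLib

/-!
# The divided derivative of box-boundary order `q·(p^L − 1)` is a residue-class projector (characteristic `p`)

Topic: `Literature/RingTheory/MvPowerSeries`. For a prime `p`, `q = p^e` and `L ≥ 0`, Lucas' theorem gives
`C(n, p^L − 1) ≡ [n ≡ −1 (mod p^L)] (mod p)` and, one `q`-block up, `C(q·k, q·(p^L − 1)) ≡ [k ≡ −1 (mod p^L)] (mod p)`.
Consequently, on a power series `f ∈ A⟦X_τ⟧` (`A` of characteristic `p`) supported on exponents that are multiples of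
`q` (`IsSupportedOnResidue q 0 f`, i.e. `f ∈ A⟦X^q⟧`), the divided derivative `Δ_K` of the BOX-BOUNDARY multi-index
`K = q(p^L − 1)·e_v = (p^{e+L} − q)·e_v` in one variable `v` acts as a PROJECTOR-AND-SHIFT: `coeff_β (Δ_K f) = coeff_{K+β} f`
when `(K+β)_v ≡ −q (mod p^{e+L})` and `= 0` otherwise (`coeff_hasseDeriv_boxBoundary`). In words: `Δ_{(p^ℓ − q)e_v}`
(`ℓ = e + L`) keeps exactly the residue class `−q mod p^ℓ` of the `v`-exponent and shifts it down by `p^ℓ − q`; it is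
`A⟦X^{p^ℓ}⟧`-linear (all coordinates of `K` are `< p^ℓ`) although its total order `p^ℓ − q` is the largest order inside the
Frobenius box.

WHY IT IS HERE (consumer): the res-hironaka cell's kill test K2.4 (slot W2.4, «bottom-member re-run» of the §9.7 diff-product with
the lex-LEAST top-block exponent γ_*; report `run/shared/lean/pub/res-hironaka/L/k24/K24-REPORT.md`, fact F4) observed that the
Case-(I) operator `u_*^{−1}·∂^{(α+pβ)}X·∂^{(qγ_*)}X` reproduces `ε` identically as soon as the `v`-digit of `γ_*` reaches `p^L − 1`;
this file is the kernel form of the binomial mechanism behind that observation. Nothing here refers to the manuscript under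
adjudication; these are statements about binomial coefficients and the tree's `hasseDeriv`.

Sources: Lucas' theorem as in Mathlib (`Choose.choose_modEq_choose_mod_mul_choose_div_nat`) through the tree's `q`-block form
`choose_add_pow_mul_add_pow_mul_modEq` (`HasseDerivResidue.lean`) and `choose_pow_mul_modEq` (`HasseDerivFrobeniusPow.lean`) ([Abad2019pBases] Lemma 6.2 arithmetic); coefficient formula
`coeff_hasseDeriv` ([Bourbaki1989CommAlg] Ch. III §4 no. 5 (21)). Elementary; no new mathematics.
-/

noncomputable section

open _root_.MvPowerSeries

namespace Literature.RingTheory.MvPowerSeries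

universe u v

variable {τ : Type v} {A : Type u} [CommRing A]

/-! ## Binomials at `p^L − 1` -/

/-- **`C(n, p^L − 1) mod p` detects the residue `−1`:** for a prime `p`,
`C(n, p^L − 1) ≡ 1 (mod p)` if `n ≡ p^L − 1 (mod p^L)` and `≡ 0 (mod p)` otherwise (Lucas: the low `L` digits of
`p^L − 1` are all `p − 1`). [cite: Abad2019pBases, Lemma 6.2 (Lucas arithmetic; kernel bookkeeping)] -/
theorem choose_pow_sub_one_modEq (p : ℕ) [hp : Fact p.Prime] (L n : ℕ) :
    n.choose (p ^ L - 1) ≡ (if n % p ^ L = p ^ L - 1 then 1 else 0) [MOD p] := by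
  have hpL : 0 < p ^ L := pow_pos hp.out.pos L
  have hlt : n % p ^ L < p ^ L := Nat.mod_lt n hpL
  have hlt' : p ^ L - 1 < p ^ L := Nat.sub_lt hpL one_pos
  -- Lucas, one `p^L`-block: `C(n % p^L + p^L (n / p^L), (p^L - 1) + p^L·0) ≡ C(n % p^L, p^L - 1)·C(n / p^L, 0)`
  have h := choose_add_pow_mul_add_pow_mul_modEq (p := p) L (n / p ^ L) 0 hlt hlt'
  rw [mul_zero, add_zero, Nat.choose_zero_right, mul_one, Nat.mod_add_div] at h
  refine h.trans ?_
  by_cases hc : n % p ^ L = p ^ L - 1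
  · rw [if_pos hc, hc, Nat.choose_self]
  · rw [if_neg hc, Nat.choose_eq_zero_of_lt (by omega)]

/-- **One `q`-block up** (`q = p^e`): `C(q·k, q·(p^L − 1)) ≡ C(k, p^L − 1) ≡ [k ≡ −1 (mod p^L)] (mod p)` (the tree's
`choose_pow_mul_modEq` followed by `choose_pow_sub_one_modEq`). [cite: Abad2019pBases, Lemma 6.2 (Lucas arithmetic; kernel bookkeeping)] -/
theorem choose_pow_mul_pow_sub_one_modEq (p : ℕ) [hp : Fact p.Prime] (e L k : ℕ) :
    (p ^ e * k).choose (p ^ e * (p ^ L - 1)) ≡ (if k % p ^ L = p ^ L - 1 then 1 else 0) [MOD p] :=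
  (choose_pow_mul_modEq hp.out e k (p ^ L - 1)).trans (choose_pow_sub_one_modEq p L k)

/-- The same, cast into a ring of characteristic `p`. [cite: Abad2019pBases, Lemma 6.2 (Lucas arithmetic; kernel bookkeeping)] -/
theorem natCast_choose_pow_mul (p : ℕ) [hp : Fact p.Prime] [CharP A p] (e L k : ℕ) :
    (((p ^ e * k).choose (p ^ e * (p ^ L - 1)) : ℕ) : A) = if k % p ^ L = p ^ L - 1 then 1 else 0 := by
  have h := CharP.natCast_eq_natCast' A p (choose_pow_mul_pow_sub_one_modEq p e L k)
  rw [h]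
  split_ifs <;> simp

/-- Residue arithmetic: for `q = p^e > 0`, `q·k ≡ q·(p^L − 1) (mod q·p^L)` iff `k ≡ p^L − 1 (mod p^L)` (stated with `%`).
[folklore] -/
private theorem mul_mod_mul_pow_eq_iff (p : ℕ) [hp : Fact p.Prime] (e L k : ℕ) :
    p ^ e * k % (p ^ e * p ^ L) = p ^ e * (p ^ L - 1) ↔ k % p ^ L = p ^ L - 1 := by
  have hq : 0 < p ^ e := pow_pos hp.out.pos e
  rw [Nat.mul_mod_mul_left]
  constructor
  · intro h; exact Nat.eq_of_mul_eq_mul_left hq h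
  · intro h; rw [h]

/-! ## The box-boundary divided derivative as a projector-and-shift -/

section Frobenius

variable (p : ℕ) [hp : Fact p.Prime] [CharP A p] [DecidableEq τ]

/-- **Box-boundary derivative = residue-class projector + shift.** Let `f ∈ A⟦X_τ⟧` (`A` of characteristic `p`) be supported
on multiples of `q = p^e` (`IsSupportedOnResidue q 0 f`), `v : τ`, `L : ℕ`, and `K := q(p^L − 1)·e_v` — the multi-index of total
order `p^{e+L} − q`, the largest `v`-order inside the Frobenius box of depth `ℓ = e + L`. Then for every `β`:
`coeff_β (Δ_K f) = coeff_{K+β} f` if `(K + β)_v ≡ q(p^L − 1) (mod q·p^L)`, and `= 0` otherwise. (So `Δ_K f` is the part of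
`f` on the `v`-residue class `−q mod p^{e+L}`, shifted down by `K`; in particular `Δ_K` is the IDENTITY-after-shift on that class
and ZERO on every other class.) [cite: Abad2019pBases, Lemma 6.2 (Lucas arithmetic behind p^e-linearity; kernel bookkeeping via `coeff_hasseDeriv`)] -/
theorem coeff_hasseDeriv_boxBoundary {e L : ℕ} {f : MvPowerSeries τ A} (hf : IsSupportedOnResidue (p ^ e) 0 f) (v : τ)
    (β : τ →₀ ℕ) :
    coeff β (hasseDeriv (Finsupp.single v (p ^ e * (p ^ L - 1))) f) =
      if (Finsupp.single v (p ^ e * (p ^ L - 1)) + β) v % (p ^ e * p ^ L) = p ^ e * (p ^ L - 1)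
      then coeff (Finsupp.single v (p ^ e * (p ^ L - 1)) + β) f else 0 := by
  classical
  set K : τ →₀ ℕ := Finsupp.single v (p ^ e * (p ^ L - 1)) with hK
  rw [coeff_hasseDeriv]
  by_cases h0 : coeff (K + β) f = 0
  · rw [h0, mul_zero]
    split_ifs <;> rfl
  · -- `(K+β)` is a multiple of `q` in every coordinate
    have hres := hf (K + β) h0
    have hdvd : ∀ s, p ^ e ∣ (K + β) s := fun s => by
      have := hres s
      rw [Finsupp.coe_zero, Pi.zero_apply] at this
      exact (Nat.modEq_zero_iff_dvd.mp this)
    -- the binomial: only the coordinate `v` matters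
    have hprod : ((K + β).prod fun s n => n.choose (K s)) = ((K + β) v).choose (p ^ e * (p ^ L - 1)) := by
      rw [Finsupp.prod, Finset.prod_eq_single v]
      · simp only [hK, Finsupp.single_eq_same]
      · intro s _ hs
        have hKs : K s = 0 := by rw [hK, Finsupp.single_apply, if_neg (Ne.symm hs)]
        rw [hKs, Nat.choose_zero_right]
      · intro hv
        rw [Finsupp.mem_support_iff, not_not] at hv
        have hKv0 : K v = 0 := by
          have : K v ≤ (K + β) v := by rw [Finsupp.add_apply]; exact Nat.le_add_right _ _
          omega
        rw [hv, hKv0, Nat.choose_zero_right]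
    obtain ⟨k, hk⟩ := hdvd v
    rw [hprod, hk, natCast_choose_pow_mul p e L k]
    by_cases hc : k % p ^ L = p ^ L - 1
    · rw [if_pos hc, one_mul, if_pos ((mul_mod_mul_pow_eq_iff p e L k).mpr hc)]
    · rw [if_neg hc, zero_mul, if_neg (fun h => hc ((mul_mod_mul_pow_eq_iff p e L k).mp h))]

/-- **Corollary (the «boundary identity» shape).** Under the same hypotheses, if in addition `f` is supported on the single
`v`-residue class `−q mod p^{e+L}` — every exponent `m` in the support has `m_v ≡ q(p^L − 1) (mod q·p^L)` — then `Δ_K` is the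
pure shift: `coeff_β (Δ_K f) = coeff_{K+β} f` for every `β`. [cite: Abad2019pBases, Lemma 6.2 (Lucas arithmetic; kernel bookkeeping)] -/
theorem coeff_hasseDeriv_boxBoundary_of_residue {e L : ℕ} {f : MvPowerSeries τ A} (hf : IsSupportedOnResidue (p ^ e) 0 f)
    (v : τ) (hv : ∀ m : τ →₀ ℕ, coeff m f ≠ 0 → m v % (p ^ e * p ^ L) = p ^ e * (p ^ L - 1)) (β : τ →₀ ℕ) :
    coeff β (hasseDeriv (Finsupp.single v (p ^ e * (p ^ L - 1))) f) =
      coeff (Finsupp.single v (p ^ e * (p ^ L - 1)) + β) f := by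
  rw [coeff_hasseDeriv_boxBoundary p hf v β]
  split_ifs with h
  · rfl
  · by_contra hne
    exact h (hv _ (Ne.symm hne))

/-- **Corollary (annihilation off the class).** Under the same hypotheses, if NO exponent in the support of `f` has
`v`-coordinate `≡ −q (mod p^{e+L})`, then `Δ_K f = 0`. [cite: Abad2019pBases, Lemma 6.2 (Lucas arithmetic; kernel bookkeeping)] -/
theorem hasseDeriv_boxBoundary_eq_zero {e L : ℕ} {f : MvPowerSeries τ A} (hf : IsSupportedOnResidue (p ^ e) 0 f) (v : τ)
    (hv : ∀ m : τ →₀ ℕ, coeff m f ≠ 0 → m v % (p ^ e * p ^ L) ≠ p ^ e * (p ^ L - 1)) :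
    hasseDeriv (Finsupp.single v (p ^ e * (p ^ L - 1))) f = 0 := by
  ext β
  rw [coeff_hasseDeriv_boxBoundary p hf v β, map_zero]
  split_ifs with h
  · by_contra hne
    exact hv _ hne h
  · rfl

end Frobenius

end Literature.RingTheory.MvPowerSeries

end
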